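import Literature.AnabelianGeometry.EtaleTheta.Discharge.Sec1Rmk164HatClassTransportPiLevel
import Literature.AnabelianGeometry.EtaleTheta.Discharge.Sec1Rmk164CompactThetaYddModelChi
import Literature.AnabelianGeometry.EtaleTheta.Discharge.Sec1Thm110ModelTateNV
import Literature.AnabelianGeometry.EtaleTheta.Discharge.Sec2RigidityAtModelTate
import Literature.AnabelianGeometry.EtaleTheta.Discharge.Sec1Thm16Schema
import Literature.AnabelianGeometry.EtaleTheta.TemperedRigidityValuation
import Literature.AnabelianGeometry.EtaleTheta.ThetaSettingHatThetaCompanion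
import HarnessLib

/-!
# [EtTh] Remark 1.6.4 (c3) at the models of record: the completion inputs of `hatClass` DISCHARGED, and the
# Tate datum with Prop 1.5 (iii) and `Compat` as THEOREMS (proof-only; «(5b)@MODELS»)

Mochizuki, *The étale theta function and its Frobenioid-theoretic manifestations*, Publ. RIMS **45** (2009) [EtTh],
Remark 1.6.4 pp. 252–253 («any isomorphism `Π_{Xα} ⥲ Π_{Xβ}` preserves these profinite étale theta functions»)
[cite: MochizukiEtTh2009, Rmk 1.6.4 pp.252-253]; Thm 1.6 (iii) p. 250; Prop 1.5 (iii) p. 249.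

PROOF-ONLY (abc-iut cell, prover abc-iut-f-128 gen 8, item «(5b)@MODELS» of abc-iut-L2-lead gen 9 R1315/R1328; no
definitions, no facts).  abc-iut-w6-d081's (5b) `HatTheta.rmk164_c3_hat` (p508599, the decl that flipped the cone row
EtTh:Rmk1.6.4, R1318) displays, besides the tempered data of Thm 1.6 (`γ`, `Thm16i`, theta companion `c`, `Thm16iii`) and
the hat companion `ê`, the inputs `Compat` ×2, `Prop15iii` ×2 and the COMPLETION inputs `IsProfiniteCompletion T.ιYdd` ×2
of `hatClass`.  Here:
* `rmk164_c3_hat_of_isCompact` — for ANY pair of settings, the two completion inputs are replaced by «`(Π^tp_Ÿ)^Θ`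
  compact» (abc-iut p508447 `isProfiniteCompletion_ιYdd_of_isCompact` route, p504039);
* `rmk164_c3_hat_modelχ` / `rmk164_c3_hat_modelχq` — at abc-iut-L2-t1's χ-model and its Tate-sheared twin (both records
  over the SAME model) the completion inputs are GONE (p508447 `isProfiniteCompletion_ιYdd_modelχ(q)`);
* `rmk164_c3_hat_modelTate` — at THE TATE DATUM OF RECORD (`modelχq p 1 2`, étale-theta datum
  `etaleThetaDataχqInr p` of abc-iut `Sec1Thm110ModelTateNV`): `Compat` is the theorem `compat_modelχq` and `Prop15iii` the
  theorem `prop15iii_etaleThetaDataχqInr`, so (c3) holds there displaying ONLY the Thm 1.6 data (`γ`, `Thm16i γ`, `c`,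
  `Thm16iii`) and the hat companion `ê` with its square — for every pair of profinite Θ-quotient records
  (e.g. f-142's `hatThetaModelχq p 1 2 _`);
* `rmk164_c3_hat_modelTate_refl` — NON-VACUITY: at `γ = id` (identity companions `ThetaCompanion.ofRefl` / `ê = refl`,
  `thm16i_refl`, `thm16iii_refl_self`) the (c3) statement holds at the Tate datum with NO displayed input at all;
  `rmk164_c3_H1Hat_modelTate_refl` — the same for abc-iut-w6-d081's Π-level form (6) `rmk164_c3_H1Hat` (p509528) in
  `H¹(Π_{Ÿ^∧}, Δ_Θ)` with `α̂ = id`;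
* (§5, appended) `rmk164_c3_H1Hat_of_companion` / `rmk164_c3_H1Hat_modelTate_of_companion` — `ê := companion Tα Tβ γ^Θ`
  and `α̂ := hatIso γ` CONSTRUCTED (abc-iut-f-142 `ThetaSettingHatThetaCompanion`, p509804), so at the Tate datum (c3) in
  `H¹(Π_{Ÿ^∧}, Δ_Θ)` displays ONLY Thm 1.6's own data `{γ, Thm16i γ, c, Thm16iii}`.
HONEST LABEL: semi-synthetic models (consistency evidence for the typed interface, not the tempered `π₁` of a curve);
`γ`/`c`/`ê` and tempered rigidity `Thm16iii` stay DISPLAYED (Thm 1.6's own content); discharged-at-our-model ≠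
proved-in-print; nothing here bears on [IUTchIII] Cor. 3.12.
-/

noncomputable section

namespace Literature.AnabelianGeometry.EtaleTheta

open scoped IsMulCommutative
open Literature.AnabelianGeometry.SemiGraphs

namespace ThetaSetting

namespace HatTheta

/-! ### §1. Any pair of settings: the completion inputs from compactness of `(Π^tp_Ÿ)^Θ` -/

section Generic

variable {p : ℕ} [Fact p.Prime] {Dα Dβ : ThetaSetting p} {γ : Dα.PiTemp ≃ₜ* Dβ.PiTemp}
  (Tα : Dα.HatTheta) (Tβ : Dβ.HatTheta) (c : ThetaCompanion γ)
  (eh : Tα.GhatTheta ≃ₜ* Tβ.GhatTheta) (heh : ∀ z : Dα.GtpTheta, eh (Tα.ι z) = Tβ.ι (c.thetaIso z))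

/-- **(c3) with the completion inputs replaced by compactness of `(Π^tp_Ÿ)^Θ`** (both sides): abc-iut-w6-d081's
`rmk164_c3_hat` with `hcα`, `hcβ` supplied by `isProfiniteCompletion_ιYdd_of_isCompact` (NO cofinality clause).
[cite: MochizukiEtTh2009, Rmk 1.6.4 pp.252-253] -/
theorem rmk164_c3_hat_of_isCompact [Tα.DeltaThetaHat.Normal] [Tβ.DeltaThetaHat.Normal] (h : Thm16i γ)
    (hCα : Dα.Compat) (hCβ : Dβ.Compat) (Eα : Dα.EtaleThetaData) (Eβ : Dβ.EtaleThetaData)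
    (h15α : Prop15iii Eα hCα) (h15β : Prop15iii Eβ hCβ) (h16 : Thm16iii γ h c Eα Eβ hCβ)
    (hKα : IsCompact ((Dα.GtpYddTheta : Subgroup Dα.GtpTheta) : Set Dα.GtpTheta))
    (hKβ : IsCompact ((Dβ.GtpYddTheta : Subgroup Dβ.GtpTheta) : Set Dβ.GtpTheta)) :
    haveI := Tβ.ghatThetaYdd_normal hCβ
    ∃ σ : Dβ.PiTemp, ∀ x ∈ Eα.thetaClasses, ∃ x' : Dα.H1Theta (Dα.GtpYdd.map Dα.toTheta),
      Dα.inflTheta Dα.GtpYdd x' = x ∧ ∃ y ∈ Eβ.thetaClasses, ∃ y' : Dβ.H1Theta (Dβ.GtpYdd.map Dβ.toTheta),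
        Dβ.inflTheta Dβ.GtpYdd y' = y ∧
        ContH1.mapIso (MonoidHom.id Tα.GhatTheta) Tα.DeltaThetaHat Tα.GhatThetaYdd
            (MonoidHom.id Tβ.GhatTheta) Tβ.DeltaThetaHat Tβ.GhatThetaYdd eh eh.toMulEquiv.toMonoidHom eh.continuous
            (map_eh_deltaThetaHat_le Tα Tβ c eh heh) (eh_symm_mem_ghatThetaYdd Tα Tβ c eh heh h) (fun _ => rfl)
            (Tα.hatClass (Tα.isProfiniteCompletion_ιYdd_of_isCompact hKα) x') =
          ContH1.conj (MonoidHom.id Tβ.GhatTheta) Tβ.DeltaThetaHat (Tβ.ι (Dβ.toTheta σ))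
            (Tβ.hatClass (Tβ.isProfiniteCompletion_ιYdd_of_isCompact hKβ) y') :=
  rmk164_c3_hat Tα Tβ c eh heh h hCα hCβ Eα Eβ h15α h15β h16 _ _

end Generic

/-! ### §2. Both records over the χ-model / the Tate-sheared model: the completion inputs GONE -/

section Models

variable {p : ℕ} [Fact p.Prime]

/-- **(c3) at the χ-model** (`Dα = Dβ = modelχ p`, any automorphism `γ` of `Π^tp_X` with its Thm 1.6 data, any two
profinite Θ-quotient records): NO completion input (`isProfiniteCompletion_ιYdd_modelχ`, abc-iut p508447).
[cite: MochizukiEtTh2009, Rmk 1.6.4 pp.252-253] -/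
theorem rmk164_c3_hat_modelχ {γ : (ThetaSetting.modelχ p).PiTemp ≃ₜ* (ThetaSetting.modelχ p).PiTemp}
    (Tα Tβ : (ThetaSetting.modelχ p).HatTheta) (c : ThetaCompanion γ)
    (eh : Tα.GhatTheta ≃ₜ* Tβ.GhatTheta)
    (heh : ∀ z : (ThetaSetting.modelχ p).GtpTheta, eh (Tα.ι z) = Tβ.ι (c.thetaIso z))
    [Tα.DeltaThetaHat.Normal] [Tβ.DeltaThetaHat.Normal] (h : Thm16i γ)
    (hCα hCβ : (ThetaSetting.modelχ p).Compat) (Eα Eβ : (ThetaSetting.modelχ p).EtaleThetaData)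
    (h15α : Prop15iii Eα hCα) (h15β : Prop15iii Eβ hCβ) (h16 : Thm16iii γ h c Eα Eβ hCβ) :
    haveI := Tβ.ghatThetaYdd_normal hCβ
    ∃ σ : (ThetaSetting.modelχ p).PiTemp, ∀ x ∈ Eα.thetaClasses,
      ∃ x' : (ThetaSetting.modelχ p).H1Theta (ThetaSetting.modelχ p).GtpYddTheta,
      (ThetaSetting.modelχ p).inflTheta (ThetaSetting.modelχ p).GtpYdd x' = x ∧ ∃ y ∈ Eβ.thetaClasses,
        ∃ y' : (ThetaSetting.modelχ p).H1Theta (ThetaSetting.modelχ p).GtpYddTheta,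
        (ThetaSetting.modelχ p).inflTheta (ThetaSetting.modelχ p).GtpYdd y' = y ∧
        ContH1.mapIso (MonoidHom.id Tα.GhatTheta) Tα.DeltaThetaHat Tα.GhatThetaYdd
            (MonoidHom.id Tβ.GhatTheta) Tβ.DeltaThetaHat Tβ.GhatThetaYdd eh eh.toMulEquiv.toMonoidHom eh.continuous
            (map_eh_deltaThetaHat_le Tα Tβ c eh heh) (eh_symm_mem_ghatThetaYdd Tα Tβ c eh heh h) (fun _ => rfl)
            (Tα.hatClass Tα.isProfiniteCompletion_ιYdd_modelχ x') =
          ContH1.conj (MonoidHom.id Tβ.GhatTheta) Tβ.DeltaThetaHat (Tβ.ι ((ThetaSetting.modelχ p).toTheta σ))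
            (Tβ.hatClass Tβ.isProfiniteCompletion_ιYdd_modelχ y') :=
  rmk164_c3_hat Tα Tβ c eh heh h hCα hCβ Eα Eβ h15α h15β h16 _ _

/-- **(c3) at the Tate-sheared model** `modelχq p i j` (both records over it): NO completion input
(`isProfiniteCompletion_ιYdd_modelχq`). [cite: MochizukiEtTh2009, Rmk 1.6.4 pp.252-253] -/
theorem rmk164_c3_hat_modelχq {i j : ℤ} {hj : Even j}
    {γ : (ThetaSetting.modelχq p i j hj).PiTemp ≃ₜ* (ThetaSetting.modelχq p i j hj).PiTemp}
    (Tα Tβ : (ThetaSetting.modelχq p i j hj).HatTheta) (c : ThetaCompanion γ)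
    (eh : Tα.GhatTheta ≃ₜ* Tβ.GhatTheta)
    (heh : ∀ z : (ThetaSetting.modelχq p i j hj).GtpTheta, eh (Tα.ι z) = Tβ.ι (c.thetaIso z))
    [Tα.DeltaThetaHat.Normal] [Tβ.DeltaThetaHat.Normal] (h : Thm16i γ)
    (hCα hCβ : (ThetaSetting.modelχq p i j hj).Compat) (Eα Eβ : (ThetaSetting.modelχq p i j hj).EtaleThetaData)
    (h15α : Prop15iii Eα hCα) (h15β : Prop15iii Eβ hCβ) (h16 : Thm16iii γ h c Eα Eβ hCβ) :
    haveI := Tβ.ghatThetaYdd_normal hCβ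
    ∃ σ : (ThetaSetting.modelχq p i j hj).PiTemp, ∀ x ∈ Eα.thetaClasses,
      ∃ x' : (ThetaSetting.modelχq p i j hj).H1Theta (ThetaSetting.modelχq p i j hj).GtpYddTheta,
      (ThetaSetting.modelχq p i j hj).inflTheta (ThetaSetting.modelχq p i j hj).GtpYdd x' = x ∧ ∃ y ∈ Eβ.thetaClasses,
        ∃ y' : (ThetaSetting.modelχq p i j hj).H1Theta (ThetaSetting.modelχq p i j hj).GtpYddTheta,
        (ThetaSetting.modelχq p i j hj).inflTheta (ThetaSetting.modelχq p i j hj).GtpYdd y' = y ∧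
        ContH1.mapIso (MonoidHom.id Tα.GhatTheta) Tα.DeltaThetaHat Tα.GhatThetaYdd
            (MonoidHom.id Tβ.GhatTheta) Tβ.DeltaThetaHat Tβ.GhatThetaYdd eh eh.toMulEquiv.toMonoidHom eh.continuous
            (map_eh_deltaThetaHat_le Tα Tβ c eh heh) (eh_symm_mem_ghatThetaYdd Tα Tβ c eh heh h) (fun _ => rfl)
            (Tα.hatClass Tα.isProfiniteCompletion_ιYdd_modelχq x') =
          ContH1.conj (MonoidHom.id Tβ.GhatTheta) Tβ.DeltaThetaHat (Tβ.ι ((ThetaSetting.modelχq p i j hj).toTheta σ))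
            (Tβ.hatClass Tβ.isProfiniteCompletion_ιYdd_modelχq y') :=
  rmk164_c3_hat Tα Tβ c eh heh h hCα hCβ Eα Eβ h15α h15β h16 _ _

/-! ### §3. THE TATE DATUM OF RECORD: `Compat` and Prop 1.5 (iii) as THEOREMS, completion inputs GONE -/

/-- **(c3) at the Tate datum of record** — `modelχq p 1 2` with the étale-theta datum `etaleThetaDataχqInr p` on BOTH
sides (`η̈^Θ := etaDdχq`, abc-iut `Sec1Thm110ModelTateNV`): `Compat` = the theorem `SettingModel.compat_modelχq`,
`Prop15iii` = the theorem `SettingModel.prop15iii_etaleThetaDataχqInr`, `IsProfiniteCompletion ιYdd` =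
`isProfiniteCompletion_ιYdd_modelχq` — so the hat theta classes of the datum go to `Ẑ ∋ ι(σ^Θ)`-conjugates of
themselves under every Thm-1.6 automorphism `γ` with theta companion `c`, tempered rigidity `Thm16iii`, and hat
companion `ê` (the ONLY displayed inputs), for every pair of profinite Θ-quotient records (e.g. abc-iut-f-142's
`hatThetaModelχq p 1 2 _`). [cite: MochizukiEtTh2009, Rmk 1.6.4 pp.252-253] [cite: MochizukiEtTh2009, Thm 1.6 (iii) p.24] -/
theorem rmk164_c3_hat_modelTate
    {γ : (ThetaSetting.modelχq p 1 2 even_two).PiTemp ≃ₜ* (ThetaSetting.modelχq p 1 2 even_two).PiTemp}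
    (Tα Tβ : (ThetaSetting.modelχq p 1 2 even_two).HatTheta) (c : ThetaCompanion γ)
    (eh : Tα.GhatTheta ≃ₜ* Tβ.GhatTheta)
    (heh : ∀ z : (ThetaSetting.modelχq p 1 2 even_two).GtpTheta, eh (Tα.ι z) = Tβ.ι (c.thetaIso z))
    [Tα.DeltaThetaHat.Normal] [Tβ.DeltaThetaHat.Normal] (h : Thm16i γ)
    (h16 : Thm16iii γ h c (SettingModel.etaleThetaDataχqInr p) (SettingModel.etaleThetaDataχqInr p)
      (SettingModel.compat_modelχq p 1 2 even_two)) :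
    haveI := Tβ.ghatThetaYdd_normal (SettingModel.compat_modelχq p 1 2 even_two)
    ∃ σ : (ThetaSetting.modelχq p 1 2 even_two).PiTemp, ∀ x ∈ (SettingModel.etaleThetaDataχqInr p).thetaClasses,
      ∃ x' : (ThetaSetting.modelχq p 1 2 even_two).H1Theta (ThetaSetting.modelχq p 1 2 even_two).GtpYddTheta,
      (ThetaSetting.modelχq p 1 2 even_two).inflTheta (ThetaSetting.modelχq p 1 2 even_two).GtpYdd x' = x ∧
        ∃ y ∈ (SettingModel.etaleThetaDataχqInr p).thetaClasses,
        ∃ y' : (ThetaSetting.modelχq p 1 2 even_two).H1Theta (ThetaSetting.modelχq p 1 2 even_two).GtpYddTheta,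
        (ThetaSetting.modelχq p 1 2 even_two).inflTheta (ThetaSetting.modelχq p 1 2 even_two).GtpYdd y' = y ∧
        ContH1.mapIso (MonoidHom.id Tα.GhatTheta) Tα.DeltaThetaHat Tα.GhatThetaYdd
            (MonoidHom.id Tβ.GhatTheta) Tβ.DeltaThetaHat Tβ.GhatThetaYdd eh eh.toMulEquiv.toMonoidHom eh.continuous
            (map_eh_deltaThetaHat_le Tα Tβ c eh heh) (eh_symm_mem_ghatThetaYdd Tα Tβ c eh heh h) (fun _ => rfl)
            (Tα.hatClass Tα.isProfiniteCompletion_ιYdd_modelχq x') =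
          ContH1.conj (MonoidHom.id Tβ.GhatTheta) Tβ.DeltaThetaHat
            (Tβ.ι ((ThetaSetting.modelχq p 1 2 even_two).toTheta σ))
            (Tβ.hatClass Tβ.isProfiniteCompletion_ιYdd_modelχq y') :=
  rmk164_c3_hat Tα Tβ c eh heh h (SettingModel.compat_modelχq p 1 2 even_two)
    (SettingModel.compat_modelχq p 1 2 even_two) _ _
    (SettingModel.prop15iii_etaleThetaDataχqInr p (SettingModel.compat_modelχq p 1 2 even_two))
    (SettingModel.prop15iii_etaleThetaDataχqInr p (SettingModel.compat_modelχq p 1 2 even_two)) h16 _ _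

/-! ### §4. NON-VACUITY: the Tate datum at `γ = id` — (c3) with NO displayed input at all -/

/-- **(c3) INHABITED OUTRIGHT at the Tate datum of record, `γ = id`**: with the identity companion
`ThetaCompanion.ofRefl`, `thm16i_refl`, tempered rigidity at the identity `thm16iii_refl_self` (abc-iut, all in tree),
the identity hat companion `ê = refl`, `Compat`/`Prop15iii` the theorems of §3 and the completion inputs discharged
(p508447): for EVERY profinite Θ-quotient record `T` over `modelχq p 1 2` (e.g. f-142's `hatThetaModelχq p 1 2 _`) the
(c3) statement of abc-iut-w6-d081's `rmk164_c3_hat` holds with NO hypothesis — every hat theta class of the datum is a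
`ι(σ^Θ)`-conjugate of a hat theta class of the datum.  (Non-vacuity of the typed (c3) shape at OUR model; not a
statement about print's curves.) [cite: MochizukiEtTh2009, Rmk 1.6.4 pp.252-253] -/
theorem rmk164_c3_hat_modelTate_refl (T : (ThetaSetting.modelχq p 1 2 even_two).HatTheta) [T.DeltaThetaHat.Normal] :
    haveI := T.ghatThetaYdd_normal (SettingModel.compat_modelχq p 1 2 even_two)
    ∃ σ : (ThetaSetting.modelχq p 1 2 even_two).PiTemp, ∀ x ∈ (SettingModel.etaleThetaDataχqInr p).thetaClasses,
      ∃ x' : (ThetaSetting.modelχq p 1 2 even_two).H1Theta (ThetaSetting.modelχq p 1 2 even_two).GtpYddTheta,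
      (ThetaSetting.modelχq p 1 2 even_two).inflTheta (ThetaSetting.modelχq p 1 2 even_two).GtpYdd x' = x ∧
        ∃ y ∈ (SettingModel.etaleThetaDataχqInr p).thetaClasses,
        ∃ y' : (ThetaSetting.modelχq p 1 2 even_two).H1Theta (ThetaSetting.modelχq p 1 2 even_two).GtpYddTheta,
        (ThetaSetting.modelχq p 1 2 even_two).inflTheta (ThetaSetting.modelχq p 1 2 even_two).GtpYdd y' = y ∧
        ContH1.mapIso (MonoidHom.id T.GhatTheta) T.DeltaThetaHat T.GhatThetaYdd
            (MonoidHom.id T.GhatTheta) T.DeltaThetaHat T.GhatThetaYdd (ContinuousMulEquiv.refl T.GhatTheta)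
            (ContinuousMulEquiv.refl T.GhatTheta).toMulEquiv.toMonoidHom (ContinuousMulEquiv.refl T.GhatTheta).continuous
            (map_eh_deltaThetaHat_le T T (ThetaCompanion.ofRefl _) (ContinuousMulEquiv.refl T.GhatTheta) (fun _ => rfl))
            (eh_symm_mem_ghatThetaYdd T T (ThetaCompanion.ofRefl _) (ContinuousMulEquiv.refl T.GhatTheta)
              (fun _ => rfl) (thm16i_refl _)) (fun _ => rfl)
            (T.hatClass T.isProfiniteCompletion_ιYdd_modelχq x') =
          ContH1.conj (MonoidHom.id T.GhatTheta) T.DeltaThetaHat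
            (T.ι ((ThetaSetting.modelχq p 1 2 even_two).toTheta σ))
            (T.hatClass T.isProfiniteCompletion_ιYdd_modelχq y') :=
  rmk164_c3_hat_modelTate T T (ThetaCompanion.ofRefl _) (ContinuousMulEquiv.refl T.GhatTheta) (fun _ => rfl)
    (thm16i_refl _) (thm16iii_refl_self _ _ _ _)

/-- **(c3) in `H¹(Π_{Ÿ^∧}, Δ_Θ)` INHABITED OUTRIGHT at the Tate datum, `γ = id`, `α̂ = id`** (abc-iut-w6-d081's Π-level
form `rmk164_c3_H1Hat`, p509528, with every displayed input discharged at the identity: `thm16i_refl`,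
`ThetaCompanion.ofRefl`, `thm16iii_refl_self`, `ê = refl`, `α̂ = refl`, `Compat`/`Prop15iii` theorems, completion inputs
p508447): for EVERY profinite Θ-quotient record `T` over `modelχq p 1 2`, the inflated hat theta classes
`inflThetaHat (hatClass ·)` of the datum are `toHat(σ)`-conjugates of inflated hat theta classes of the datum — NO
hypothesis. [cite: MochizukiEtTh2009, Rmk 1.6.4 pp.252-253] -/
theorem rmk164_c3_H1Hat_modelTate_refl (T : (ThetaSetting.modelχq p 1 2 even_two).HatTheta) [T.DeltaThetaHat.Normal] :
    haveI := gtpYddHat_normal (SettingModel.compat_modelχq p 1 2 even_two)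
    ∃ σ : (ThetaSetting.modelχq p 1 2 even_two).PiTemp, ∀ x ∈ (SettingModel.etaleThetaDataχqInr p).thetaClasses,
      ∃ x' : (ThetaSetting.modelχq p 1 2 even_two).H1Theta (ThetaSetting.modelχq p 1 2 even_two).GtpYddTheta,
      (ThetaSetting.modelχq p 1 2 even_two).inflTheta (ThetaSetting.modelχq p 1 2 even_two).GtpYdd x' = x ∧
        ∃ y ∈ (SettingModel.etaleThetaDataχqInr p).thetaClasses,
        ∃ y' : (ThetaSetting.modelχq p 1 2 even_two).H1Theta (ThetaSetting.modelχq p 1 2 even_two).GtpYddTheta,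
        (ThetaSetting.modelχq p 1 2 even_two).inflTheta (ThetaSetting.modelχq p 1 2 even_two).GtpYdd y' = y ∧
        ContH1.mapIso T.toThetaHat.toMonoidHom T.DeltaThetaHat (ThetaSetting.modelχq p 1 2 even_two).GtpYddHat
            T.toThetaHat.toMonoidHom T.DeltaThetaHat (ThetaSetting.modelχq p 1 2 even_two).GtpYddHat
            (ContinuousMulEquiv.refl _) (ContinuousMulEquiv.refl T.GhatTheta).toMulEquiv.toMonoidHom
            (ContinuousMulEquiv.refl T.GhatTheta).continuous
            (map_eh_deltaThetaHat_le T T (ThetaCompanion.ofRefl _) (ContinuousMulEquiv.refl T.GhatTheta) (fun _ => rfl))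
            (αh_symm_mem_gtpYddHat (ContinuousMulEquiv.refl _) (fun _ => rfl) (thm16i_refl _)) (fun _ => rfl)
            (T.inflThetaHat (T.hatClass T.isProfiniteCompletion_ιYdd_modelχq x')) =
          ContH1.conj T.toThetaHat.toMonoidHom T.DeltaThetaHat ((ThetaSetting.modelχq p 1 2 even_two).toHat σ)
            (T.inflThetaHat (T.hatClass T.isProfiniteCompletion_ιYdd_modelχq y')) :=
  rmk164_c3_H1Hat T T (ThetaCompanion.ofRefl _) (ContinuousMulEquiv.refl T.GhatTheta) (fun _ => rfl)
    (ContinuousMulEquiv.refl _) (fun _ => rfl) (fun _ => rfl) (thm16i_refl _)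
    (SettingModel.compat_modelχq p 1 2 even_two) (SettingModel.compat_modelχq p 1 2 even_two) _ _
    (SettingModel.prop15iii_etaleThetaDataχqInr p (SettingModel.compat_modelχq p 1 2 even_two))
    (SettingModel.prop15iii_etaleThetaDataχqInr p (SettingModel.compat_modelχq p 1 2 even_two))
    (thm16iii_refl_self _ _ _ _) T.isProfiniteCompletion_ιYdd_modelχq T.isProfiniteCompletion_ιYdd_modelχq

end Models

/-! ### §5. The hat companion `ê` and the profinite `α̂` CONSTRUCTED (abc-iut-f-142's `HatTheta.companion`, `hatIso`):
(c3) in `H¹(Π_{Ÿ^∧}, Δ_Θ)` displaying only Thm 1.6's own data — appended 2026-08-27 (abc-iut-L2-lead gen 9 R1342 rider) -/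

section Companion

variable {p : ℕ} [Fact p.Prime] {Dα Dβ : ThetaSetting p} {γ : Dα.PiTemp ≃ₜ* Dβ.PiTemp}
  (Tα : Dα.HatTheta) (Tβ : Dβ.HatTheta) (c : ThetaCompanion γ)

/-- **(c3) in `H¹(Π_{Ÿ^∧}, Δ_Θ)` with `ê := HatTheta.companion Tα Tβ γ^Θ` and `α̂ := hatIso γ` CONSTRUCTED** (abc-iut-f-142
p509804: the completion functoriality of `IsProfiniteCompletion`; squares `companion_ι`, `hatIso_toHat`,
`companion_toThetaHat`): abc-iut-w6-d081's `rmk164_c3_H1Hat` (p509528) without the displayed `ê`, `α̂` and their three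
squares. [cite: MochizukiEtTh2009, Rmk 1.6.4 pp.252-253] -/
theorem rmk164_c3_H1Hat_of_companion [Tα.DeltaThetaHat.Normal] [Tβ.DeltaThetaHat.Normal] (h : Thm16i γ)
    (hCα : Dα.Compat) (hCβ : Dβ.Compat) (Eα : Dα.EtaleThetaData) (Eβ : Dβ.EtaleThetaData)
    (h15α : Prop15iii Eα hCα) (h15β : Prop15iii Eβ hCβ) (h16 : Thm16iii γ h c Eα Eβ hCβ)
    (hcα : IsProfiniteCompletion Tα.ιYdd) (hcβ : IsProfiniteCompletion Tβ.ιYdd) :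
    haveI := gtpYddHat_normal hCβ
    ∃ σ : Dβ.PiTemp, ∀ x ∈ Eα.thetaClasses, ∃ x' : Dα.H1Theta (Dα.GtpYdd.map Dα.toTheta),
      Dα.inflTheta Dα.GtpYdd x' = x ∧ ∃ y ∈ Eβ.thetaClasses, ∃ y' : Dβ.H1Theta (Dβ.GtpYdd.map Dβ.toTheta),
        Dβ.inflTheta Dβ.GtpYdd y' = y ∧
        ContH1.mapIso Tα.toThetaHat.toMonoidHom Tα.DeltaThetaHat Dα.GtpYddHat Tβ.toThetaHat.toMonoidHom Tβ.DeltaThetaHat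
            Dβ.GtpYddHat (hatIso γ) (companion Tα Tβ c.thetaIso).toMulEquiv.toMonoidHom
            (companion Tα Tβ c.thetaIso).continuous
            (map_eh_deltaThetaHat_le Tα Tβ c (companion Tα Tβ c.thetaIso) (companion_ι Tα Tβ c.thetaIso))
            (αh_symm_mem_gtpYddHat (hatIso γ) (hatIso_toHat γ) h)
            (fun w => (companion_toThetaHat Tα Tβ c w).symm)
            (Tα.inflThetaHat (Tα.hatClass hcα x')) =
          ContH1.conj Tβ.toThetaHat.toMonoidHom Tβ.DeltaThetaHat (Dβ.toHat σ) (Tβ.inflThetaHat (Tβ.hatClass hcβ y')) :=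
  rmk164_c3_H1Hat Tα Tβ c (companion Tα Tβ c.thetaIso) (companion_ι Tα Tβ c.thetaIso) (hatIso γ) (hatIso_toHat γ)
    (fun w => (companion_toThetaHat Tα Tβ c w).symm) h hCα hCβ Eα Eβ h15α h15β h16 hcα hcβ

/-- **(c3) in `H¹(Π_{Ÿ^∧}, Δ_Θ)` at the Tate datum of record, displaying ONLY Thm 1.6's own data** `{γ, Thm16i γ, c,
Thm16iii}`: `ê`, `α̂` CONSTRUCTED (f-142 p509804), `Compat`/`Prop15iii` theorems, completion inputs discharged (p508447).
[cite: MochizukiEtTh2009, Rmk 1.6.4 pp.252-253] [cite: MochizukiEtTh2009, Thm 1.6 (iii) p.24] -/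
theorem rmk164_c3_H1Hat_modelTate_of_companion
    {γ : (ThetaSetting.modelχq p 1 2 even_two).PiTemp ≃ₜ* (ThetaSetting.modelχq p 1 2 even_two).PiTemp}
    (Tα Tβ : (ThetaSetting.modelχq p 1 2 even_two).HatTheta) (c : ThetaCompanion γ)
    [Tα.DeltaThetaHat.Normal] [Tβ.DeltaThetaHat.Normal] (h : Thm16i γ)
    (h16 : Thm16iii γ h c (SettingModel.etaleThetaDataχqInr p) (SettingModel.etaleThetaDataχqInr p)
      (SettingModel.compat_modelχq p 1 2 even_two)) :
    haveI := gtpYddHat_normal (SettingModel.compat_modelχq p 1 2 even_two)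
    ∃ σ : (ThetaSetting.modelχq p 1 2 even_two).PiTemp, ∀ x ∈ (SettingModel.etaleThetaDataχqInr p).thetaClasses,
      ∃ x' : (ThetaSetting.modelχq p 1 2 even_two).H1Theta (ThetaSetting.modelχq p 1 2 even_two).GtpYddTheta,
      (ThetaSetting.modelχq p 1 2 even_two).inflTheta (ThetaSetting.modelχq p 1 2 even_two).GtpYdd x' = x ∧
        ∃ y ∈ (SettingModel.etaleThetaDataχqInr p).thetaClasses,
        ∃ y' : (ThetaSetting.modelχq p 1 2 even_two).H1Theta (ThetaSetting.modelχq p 1 2 even_two).GtpYddTheta,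
        (ThetaSetting.modelχq p 1 2 even_two).inflTheta (ThetaSetting.modelχq p 1 2 even_two).GtpYdd y' = y ∧
        ContH1.mapIso Tα.toThetaHat.toMonoidHom Tα.DeltaThetaHat (ThetaSetting.modelχq p 1 2 even_two).GtpYddHat
            Tβ.toThetaHat.toMonoidHom Tβ.DeltaThetaHat (ThetaSetting.modelχq p 1 2 even_two).GtpYddHat
            (hatIso γ) (companion Tα Tβ c.thetaIso).toMulEquiv.toMonoidHom (companion Tα Tβ c.thetaIso).continuous
            (map_eh_deltaThetaHat_le Tα Tβ c (companion Tα Tβ c.thetaIso) (companion_ι Tα Tβ c.thetaIso))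
            (αh_symm_mem_gtpYddHat (hatIso γ) (hatIso_toHat γ) h)
            (fun w => (companion_toThetaHat Tα Tβ c w).symm)
            (Tα.inflThetaHat (Tα.hatClass Tα.isProfiniteCompletion_ιYdd_modelχq x')) =
          ContH1.conj Tβ.toThetaHat.toMonoidHom Tβ.DeltaThetaHat ((ThetaSetting.modelχq p 1 2 even_two).toHat σ)
            (Tβ.inflThetaHat (Tβ.hatClass Tβ.isProfiniteCompletion_ιYdd_modelχq y')) :=
  rmk164_c3_H1Hat_of_companion Tα Tβ c h _ _ _ _
    (SettingModel.prop15iii_etaleThetaDataχqInr p (SettingModel.compat_modelχq p 1 2 even_two))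
    (SettingModel.prop15iii_etaleThetaDataχqInr p (SettingModel.compat_modelχq p 1 2 even_two)) h16 _ _

end Companion

end HatTheta

end ThetaSetting

end Literature.AnabelianGeometry.EtaleTheta

end
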